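import Summits.Ventures.YMGap.Census.CrossingWeightRP
import HarnessLib

/-!
# Venture YMGap, track (b) — transport of the marked-plaquette integral: every plaquette of the even symmetric
# torus is a crossing plaquette up to a lattice symmetry

HONEST FRAMING: venture file of the cell `pub-ymgap` (QuantumFields programme), track (b); finite-volume lattice
gauge theory only (E. T. Tomboulis, arXiv:0707.2179, §II and App. A, "reflection positivity in planes without
sites").  Nothing here concerns (5.15), the thermodynamic limit, confinement or a mass gap.

The MARKED-PLAQUETTE INTEGRAL `markedIntegral J c k p₀ = ∫ d_k χ_k(U_{p₀}) ∏_{p ≠ p₀} f_c(U_p) dU` of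
`CrossingWeightRP` is non-negative when `p₀` is bisected by the reflection hyperplane
(`markedIntegral_nonneg_of_isCrossPlaq`).  This file carries EVERY plaquette `p₀ = (x, (i, j))` of the symmetric torus
`(ℤ/Lℤ)^d` to such a position: the transposition of the axes `0 ↔ i` (`configTranspose` of
`TwistedPartitionFunction`; the `SU(2)` plaquette functions are inversion invariant, so the orientation reversal of a
transposed plaquette is harmless, `apply_hol_configTranspose`) followed by a lattice translation (`configShift`, this
file); both preserve the product Haar measure (`measurePreserving_configShiftEquiv`,
`measurePreserving_configTransposeEquiv`) and hence the marked integral (`markedIntegral_plaqTranspose`,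
`markedIntegral_shift`).  Consequence: **`markedIntegral_nonneg`** — for even `L`, `c_j ≥ 0` (`j ≥ 1`) and `k ≤ J`,
`0 ≤ markedIntegral J c k p₀` for every plaquette `p₀`.  This is the positivity input of Tomboulis's Prop. II.1 (i)
(`CoeffMonotone.lean`).

## Main statements (namespace `Summit.Ventures.YMGap.Census`)

* `configShift`, `configShiftEquiv`, `measurePreserving_configShiftEquiv`, `plaquetteHolonomy_configShift`,
  `plaqShift` — lattice translations of configurations and plaquettes.
* `su2Char_inv'`, `plaqFn_inv'`, `apply_hol_configTranspose` — transposed holonomies inside inversion-invariant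
  plaquette functions.
* `markedFn`, `markedIntegral_eq`, `markedIntegral_shift`, `markedIntegral_plaqTranspose`, **`markedIntegral_nonneg`**.

References: E. T. Tomboulis, arXiv:0707.2179, Prop. II.1 (i), App. A [cite: Tomboulis2007Confinement, App. A];
K. Osterwalder, E. Seiler, Ann. Phys. 110 (1978) 440, §2 [cite: OsterwalderSeilerAnnPhys1978, §2].
-/

noncomputable section

open MeasureTheory Finset Real
open scoped BigOperators
open Literature.MathematicalPhysics.QuantumLattice
open Literature.MathematicalPhysics.QuantumFieldTheory
open Literature.MathematicalPhysics.QuantumFieldTheory.Tomboulis2007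
open Literature.MathematicalPhysics.QuantumFieldTheory.WilsonRP

namespace Summit.Ventures.YMGap.Census

variable {d L : ℕ}

/-! ### Lattice translations -/

/-- Relabelling the link variables by the lattice translation `x ↦ x + v`. -/
def configShift {G : Type*} (v : Site d L) (U : GaugeConfig d L G) : GaugeConfig d L G :=
  fun e => U (e.1 + v, e.2)

/-- Plaquette holonomies of the translated configuration are the translated plaquette holonomies. -/
theorem plaquetteHolonomy_configShift {G : Type*} [Group G] (v : Site d L) (U : GaugeConfig d L G)
    (x : Site d L) (i j : Fin d) :
    plaquetteHolonomy (configShift v U) x i j = plaquetteHolonomy U (x + v) i j := by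
  -- `(y + v) + e_k = (y + e_k) + v` (the tree's `LatticeStokes.add_shift`, not imported here)
  have h : ∀ (y : Site d L) (k : Fin d), (y + v).shift k = y.shift k + v := fun y k => by
    unfold Site.shift
    abel
  simp only [plaquetteHolonomy, configShift, h]

/-- Translation of configurations as a measurable automorphism (`MeasurableEquiv.arrowCongr'`). -/
def configShiftEquiv {G : Type*} [MeasurableSpace G] (v : Site d L) : GaugeConfig d L G ≃ᵐ GaugeConfig d L G :=
  MeasurableEquiv.arrowCongr' (Equiv.prodCongr (Equiv.addRight v) (Equiv.refl (Fin d))).symm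
    (MeasurableEquiv.refl G)

/-- `configShiftEquiv v` acts as `configShift v`. -/
@[simp] theorem configShiftEquiv_apply {G : Type*} [MeasurableSpace G] (v : Site d L) (U : GaugeConfig d L G) :
    configShiftEquiv v U = configShift v U := by
  funext e
  rfl

/-- **Translations preserve the product Haar measure** (they only relabel the links;
`MeasureTheory.measurePreserving_arrowCongr'`). -/
theorem measurePreserving_configShiftEquiv {G : Type*} [MeasurableSpace G] (μ₀ : Measure G) [SigmaFinite μ₀]
    [NeZero L] (v : Site d L) :
    MeasurePreserving (configShiftEquiv (G := G) v) (Measure.pi fun _ : Edge d L => μ₀)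
      (Measure.pi fun _ : Edge d L => μ₀) :=
  measurePreserving_arrowCongr' (fun _ : Edge d L => μ₀) (fun _ : Edge d L => μ₀)
    (Equiv.prodCongr (Equiv.addRight v) (Equiv.refl (Fin d))).symm (MeasurableEquiv.refl G)
    fun _ => MeasurePreserving.id _

/-- Translation of plaquettes. -/
def plaqShift (v : Site d L) (p : Plaquette d L) : Plaquette d L := (p.1 + v, p.2)

/-- Translation of plaquettes as a permutation. -/
def plaqShiftEquiv (v : Site d L) : Equiv.Perm (Plaquette d L) :=
  Equiv.prodCongr (Equiv.addRight v) (Equiv.refl _)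

/-- `plaqShiftEquiv v` acts as `plaqShift v`. -/
theorem plaqShiftEquiv_apply (v : Site d L) (p : Plaquette d L) : plaqShiftEquiv v p = plaqShift v p := by
  obtain ⟨x, q⟩ := p
  rfl

/-- `plaqShift v` is injective. -/
theorem plaqShift_injective (v : Site d L) : Function.Injective (plaqShift (d := d) (L := L) v) := by
  intro p q h
  have h' : plaqShiftEquiv v p = plaqShiftEquiv v q := by rwa [plaqShiftEquiv_apply, plaqShiftEquiv_apply]
  exact (plaqShiftEquiv v).injective h'

/-! ### `SU(2)` plaquette functions are inversion invariant (for the transposition of the axes) -/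

/-- `χ_n(W⁻¹) = χ_n(W)` (all `SU(2)` characters are real; `Re tr W⁻¹ = Re tr W`). -/
theorem su2Char_inv' (n : ℕ) (W : SU2) : su2Char n W⁻¹ = su2Char n W := by
  have h := Literature.RepresentationTheory.CompactGroups.CompactGroup.re_trace_map_inv
    (fundamentalRep (Fin 2)) (continuous_fundamentalRep (Fin 2)) W
  simp only [fundamentalRep_apply] at h
  unfold su2Char
  rw [h]

/-- `f(W⁻¹) = f(W)`. -/
theorem plaqFn_inv' (J : ℕ) (c : ℕ → ℝ) (W : SU2) : plaqFn J c W⁻¹ = plaqFn J c W := by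
  simp only [plaqFn, su2Char_inv']

/-- Reversing the orientation of a plaquette inverts its holonomy. -/
theorem plaquetteHolonomy_rev' {G : Type*} [Group G] (U : GaugeConfig d L G) (x : Site d L) (i j : Fin d) :
    plaquetteHolonomy U x j i = (plaquetteHolonomy U x i j)⁻¹ := by
  simp only [plaquetteHolonomy, mul_inv_rev, inv_inv, mul_assoc]

/-- For an inversion-invariant `g`, `g(U^τ_p) = g(U_{τp})` under the transposition of the axes `μ ↔ ν`. -/
theorem apply_hol_configTranspose {G : Type*} [Group G] {α : Type*} (g : G → α) (hg : ∀ W, g W⁻¹ = g W)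
    (μ ν : Fin d) (U : GaugeConfig d L G) (p : Plaquette d L) :
    g (plaquetteHolonomy (configTranspose μ ν U) p.1 p.2.1.1 p.2.1.2) =
      g (plaquetteHolonomy U (plaqTranspose μ ν p).1 (plaqTranspose μ ν p).2.1.1 (plaqTranspose μ ν p).2.1.2) := by
  rw [plaquetteHolonomy_configTranspose]
  obtain ⟨x, ⟨⟨a, b⟩, hab⟩⟩ := p
  simp only [plaqTranspose, dirTranspose]
  split_ifs with h
  · rfl
  · rw [plaquetteHolonomy_rev' U (siteTranspose μ ν x) (Equiv.swap μ ν a) (Equiv.swap μ ν b), hg]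

/-- `plaqTranspose μ ν` is injective (an involution, `plaqTransposeEquiv`). -/
theorem plaqTranspose_injective (μ ν : Fin d) : Function.Injective (plaqTranspose (d := d) (L := L) μ ν) :=
  (plaqTransposeEquiv (L := L) μ ν).injective

section Marked

variable [NeZero d] [NeZero L] [Fact (1 < L)]

/-- The integrand of the marked-plaquette integral. -/
def markedFn (J : ℕ) (c : ℕ → ℝ) (k : ℕ) (p₀ : Plaquette d L) (W : GaugeConfig d L SU2) : ℝ :=
  ∏ p, (if p = p₀ then ((k : ℝ) + 1) * su2Char k (plaquetteHolonomy W p.1 p.2.1.1 p.2.1.2)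
    else plaqFn J c (plaquetteHolonomy W p.1 p.2.1.1 p.2.1.2))

omit [NeZero d] [Fact (1 < L)] in
/-- `markedIntegral = ∫ markedFn`. -/
theorem markedIntegral_eq (J : ℕ) (c : ℕ → ℝ) (k : ℕ) (p₀ : Plaquette d L) :
    markedIntegral J c k p₀ = ∫ W, markedFn J c k p₀ W ∂(Measure.pi fun _ : Edge d L => haarProbability SU2) :=
  rfl

/-! ### Invariance of the marked integral under translations and transpositions -/

omit [NeZero d] [Fact (1 < L)] in
/-- The marked integrand intertwines translations: `markedFn p₀ (U ∘ shift_v) = markedFn (p₀ + v) U`. -/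
theorem markedFn_configShift (J : ℕ) (c : ℕ → ℝ) (k : ℕ) (p₀ : Plaquette d L) (v : Site d L)
    (W : GaugeConfig d L SU2) :
    markedFn J c k p₀ (configShift v W) = markedFn J c k (plaqShift v p₀) W := by
  unfold markedFn
  simp only [plaquetteHolonomy_configShift]
  refine Fintype.prod_equiv (plaqShiftEquiv v) _ _ fun p => ?_
  rw [plaqShiftEquiv_apply]
  by_cases hp : p = p₀
  · subst hp
    rw [if_pos rfl, if_pos rfl]
    rfl
  · rw [if_neg hp, if_neg (fun h => hp (plaqShift_injective v h))]
    rfl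

omit [NeZero d] [Fact (1 < L)] in
/-- **Translation invariance of the marked integral**: `M(p₀ + v) = M(p₀)`. -/
theorem markedIntegral_shift (J : ℕ) (c : ℕ → ℝ) (k : ℕ) (p₀ : Plaquette d L) (v : Site d L) :
    markedIntegral J c k (plaqShift v p₀) = markedIntegral J c k p₀ := by
  rw [markedIntegral_eq, markedIntegral_eq,
    ← (measurePreserving_configShiftEquiv (haarProbability SU2) v).integral_comp' (markedFn J c k p₀)]
  refine integral_congr_ae (ae_of_all _ fun W => ?_)
  simp only [configShiftEquiv_apply, markedFn_configShift]

omit [NeZero d] [Fact (1 < L)] in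
/-- The marked integrand intertwines transpositions: `markedFn p₀ (U ∘ τ) = markedFn (τ p₀) U`. -/
theorem markedFn_configTranspose (J : ℕ) (c : ℕ → ℝ) (k : ℕ) (p₀ : Plaquette d L) (μ ν : Fin d)
    (W : GaugeConfig d L SU2) :
    markedFn J c k p₀ (configTranspose μ ν W) = markedFn J c k (plaqTranspose μ ν p₀) W := by
  unfold markedFn
  have hfac : ∀ p : Plaquette d L,
      (if p = p₀ then ((k : ℝ) + 1) * su2Char k (plaquetteHolonomy (configTranspose μ ν W) p.1 p.2.1.1 p.2.1.2)
        else plaqFn J c (plaquetteHolonomy (configTranspose μ ν W) p.1 p.2.1.1 p.2.1.2)) =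
      (if plaqTranspose μ ν p = plaqTranspose μ ν p₀ then ((k : ℝ) + 1) *
          su2Char k (plaquetteHolonomy W (plaqTranspose μ ν p).1 (plaqTranspose μ ν p).2.1.1
            (plaqTranspose μ ν p).2.1.2)
        else plaqFn J c (plaquetteHolonomy W (plaqTranspose μ ν p).1 (plaqTranspose μ ν p).2.1.1
            (plaqTranspose μ ν p).2.1.2)) := by
    intro p
    by_cases hp : p = p₀
    · subst hp
      rw [if_pos rfl, if_pos rfl, apply_hol_configTranspose (su2Char k) (su2Char_inv' k)]
    · rw [if_neg hp, if_neg (fun h => hp (plaqTranspose_injective μ ν h)),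
        apply_hol_configTranspose (plaqFn J c) (plaqFn_inv' J c)]
  rw [Finset.prod_congr rfl fun p _ => hfac p]
  exact Fintype.prod_equiv (plaqTransposeEquiv μ ν) _ _ fun p => rfl

omit [NeZero d] [Fact (1 < L)] in
/-- **Transposition invariance of the marked integral**: `M(τ p₀) = M(p₀)` (arXiv:0707.2179: the axes of the
symmetric torus are interchangeable). -/
theorem markedIntegral_plaqTranspose (J : ℕ) (c : ℕ → ℝ) (k : ℕ) (p₀ : Plaquette d L) (μ ν : Fin d) :
    markedIntegral J c k (plaqTranspose μ ν p₀) = markedIntegral J c k p₀ := by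
  rw [markedIntegral_eq, markedIntegral_eq,
    ← (measurePreserving_configTransposeEquiv (G := SU2) μ ν).integral_comp' (markedFn J c k p₀)]
  refine integral_congr_ae (ae_of_all _ fun W => ?_)
  simp only [configTransposeEquiv_apply, markedFn_configTranspose]

/-- **The marked-plaquette integral is non-negative for EVERY plaquette of the even symmetric torus**
(`c_j ≥ 0`, `k ≤ J`): transport the plaquette to one bisected by the reflection hyperplane `t = 1/2` (transpose its
first direction with the time axis, then translate its base point to the origin) and apply
`markedIntegral_nonneg_of_isCrossPlaq`. -/
theorem markedIntegral_nonneg (hL : Even L) (J : ℕ) {c : ℕ → ℝ} (hc : ∀ n, 1 ≤ n → 0 ≤ c n) {k : ℕ}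
    (hkJ : k ≤ J) (p₀ : Plaquette d L) : 0 ≤ markedIntegral J c k p₀ := by
  obtain ⟨x, ⟨⟨i, j⟩, hij⟩⟩ := p₀
  -- transpose the axes `0 ↔ i`: the plane becomes `(0, j)`
  set q : Plaquette d L := plaqTranspose 0 i (x, ⟨(i, j), hij⟩) with hq
  have hij' : i < j := hij
  have hj0 : j ≠ 0 := fun h => by rw [h] at hij'; exact (Fin.not_lt_zero i) hij'
  have hji : j ≠ i := ne_of_gt hij'
  have hq1 : q.2.1.1 = 0 := by
    have hswi : Equiv.swap (0 : Fin d) i i = 0 := Equiv.swap_apply_right _ _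
    have hswj : Equiv.swap (0 : Fin d) i j = j := Equiv.swap_apply_of_ne_of_ne hj0 hji
    have hlt : Equiv.swap (0 : Fin d) i i < Equiv.swap (0 : Fin d) i j := by
      rw [hswi, hswj]; exact lt_of_le_of_ne (Fin.zero_le _) (Ne.symm hj0)
    have hdt : dirTranspose (0 : Fin d) i ⟨(i, j), hij⟩ =
        ⟨(Equiv.swap (0 : Fin d) i i, Equiv.swap (0 : Fin d) i j), hlt⟩ := by
      unfold dirTranspose
      rw [dif_pos hlt]
    rw [hq, plaqTranspose, hdt]
    exact hswi
  -- translate the base point to the origin: the plaquette becomes crossing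
  set r : Plaquette d L := plaqShift (-q.1) q with hr
  have hr_cross : IsCrossPlaq r := by
    refine ⟨?_, Or.inl ?_⟩
    · simpa [hr, plaqShift] using hq1
    · simp [hr, plaqShift]
  have h1 : markedIntegral J c k (x, ⟨(i, j), hij⟩) = markedIntegral J c k q := by
    rw [hq, markedIntegral_plaqTranspose]
  have h2 : markedIntegral J c k q = markedIntegral J c k r := by
    rw [hr, markedIntegral_shift]
  rw [h1, h2]
  exact markedIntegral_nonneg_of_isCrossPlaq hL J hc hkJ hr_cross

end Marked

end Summit.Ventures.YMGap.Census

end
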